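import Literature.NumberTheory.GaloisRepresentations.LubinTateColemanCoordMomentsTwistTwo
import Literature.NumberTheory.GaloisRepresentations.LubinTateColemanCoordModuleTwo
import Literature.NumberTheory.GaloisRepresentations.PowerSeriesTopNilpotentIntertwine
import HarnessLib

/-!
# The moment functionals of the Coleman coordinate module at `q = 2` are `Λ`-LINEAR: `mom_k(c • r) = c(γ^{k+1} − 1) · mom_k(r)` for
# every `c ∈ Λ = 𝒪_E⟦T⟧` — the WEIGHT-`(k+1)` SPECIALISATIONS `M → 𝒪_E(χ^{k+1})` (de Shalit I §3.5 (i)–(ii) in module currency)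

De Shalit, *Iwasawa theory of elliptic curves with complex multiplication* (1987), Ch. I §3.5: the Coates–Wiles homomorphisms
`φ_k(β) = D^k log g_β(0) = ∫ κ^k dμ_β` are `ℤ_p`-linear and satisfy `φ_k(γβ) = κ(γ)^k φ_k(β)` — i.e. they are `Λ = ℤ_p⟦𝒢⟧`-module maps
`𝒰 → 𝒪(κ^k)`, the specialisations of the Iwasawa module of local units at the characters `κ^k` (Washington §13.2: a `Λ`-map into `ℤ_p(χ)` is
`f(T) ↦ f(χ(γ) − 1)`).  In the tree's series currency at `q = 2` (`LubinTateColemanCoordMomentsTwo`/`…TwistTwo`): the coordinate module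
`M = ColemanCoordModule` (`= 𝒪_E⟦Y⟧` over `Λ = 𝒪_E⟦T⟧`, `T ↦ D_γ = σ_γ − 1`) carries the functionals `mom_k(r) = [X⁰] D_E^[k]((1+u⁻¹X)(r ∘ f))`
with `mom_k(D_v r) = (v^{k+1} − 1)·mom_k(r)` (proved there for the OPERATORS `D_v`, i.e. for polynomials in `T`).  THIS file extends the
linearity to ALL of `Λ` by `(π, Y)`-adic continuity (`PowerSeriesTopNilpotentIntertwine.apply_tAct_eq_tEval_mul`); everything PROVED (0 sorry):

* §1 (generic) `LubinTate.subst_mem_adicFiltGen_of_constantCoeff_eq_zero` — `r ∈ I_N ⟹ r ∘ g ∈ I_N` for `g(0) = 0`;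
* §2 ADIC CONTINUITY of the moments: `coordToKer_mem_adicFiltGen` (`Φ(I_N) ⊆ I_N`), `iterate_relDerivation_mem_adicFiltGen`
  (`D_E^[k](I_{N+k}) ⊆ I_N`), ★ `coordMoment_mem_of_mem_adicFiltGen` (**`mom_k(I_{N+k}) ⊆ (π^N)`**); `coordMomentₗ` (`mom_k` as an
  `𝒪_E`-linear functional); `algebraMap_unit_pow_sub_one_mem` (`γ^{k+1} − 1 ∈ (π)𝒪_E` at `q = 2`);
* §3 ★★★ **`coordMoment_tAct` / `coordMoment_smul`** — **`mom_k(c • r) = c(γ^{k+1} − 1) · mom_k(r)` for every `c ∈ 𝒪_E⟦T⟧` and every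
  `r ∈ M`** (`tEval` the `(π)`-adic evaluation `T ↦ γ^{k+1} − 1`); `coordMoment_X_sub_C_smul` (**`mom_k` kills `(T − (γ^{k+1} − 1))·M`**),
  `coordMoment_one_add_X_pow_smul` (`(1+T)^n ↦ γ^{n(k+1)}`), ★ `coordMoment_unitTwistₗ` (`mom_k(σ_v r) = v^{k+1} mom_k(r)`: together, `mom_k`
  is a morphism of `Λ(𝒢)`-modules `M → 𝒪_E(χ^{k+1})`, `𝒢 = 𝒪_F^×`), ★ `coordMomentΛ` (the `Λ`-linear map into the weight module
  `𝒪_E⟦Y⟧(γ^{k+1} − 1)` of `PowerSeriesTopNilpotentIntertwine`);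
* §4 on the coordinates of the UNITS (`N = Col(𝒰) ≤ M`): `coordMoment_smul_relUnitCoordTwo_eq_coatesWiles` — **`mom_k(c • r_β) = c(γ^{k+1} − 1) ·
  (c_β − u·π^k·φ(c_β))`**, `c_β = φ^{CW,E}_{k+1}(β)` the relative Coates–Wiles value (de Shalit II §4.7 (17)): the `Λ`-span of the coordinates of
  the units is read at weight `k+1` through the Euler-twisted Coates–Wiles homomorphism.

## References
* E. de Shalit, *Iwasawa theory of elliptic curves with complex multiplication* (1987), Ch. I §3.1, §3.4 Lemma (ii), §3.5 (11) (i)–(ii), §3.7;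
  Ch. II §4.7 (17). [deShalit1987]
* L. C. Washington, *Introduction to Cyclotomic Fields*, 2nd ed. (1997), §13.2. [Washington1997]
-/

noncomputable section

open PowerSeries

namespace Literature.NumberTheory.GaloisRepresentations

/-! ### §1. Substitution preserves the `(p, Y)`-adic filtration -/

namespace LubinTate

section SubstFilt

variable {S : Type*} [CommRing S] {p : S}

/-- **`r ∈ I_N ⟹ r ∘ g ∈ I_N`** for every `g` with `g(0) = 0` (`r = c + Y·r′` gives `r ∘ g = c + g·(r′ ∘ g)`, `g ∈ I_1`; induction on `N`).
[cite: deShalit1987, Ch. I §3.13 Lemma (proof)] -/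
theorem subst_mem_adicFiltGen_of_constantCoeff_eq_zero {g : PowerSeries S} (hg0 : PowerSeries.constantCoeff g = 0) :
    ∀ (N : ℕ) {r : PowerSeries S}, r ∈ adicFiltGen p N → PowerSeries.subst g r ∈ adicFiltGen p N := by
  have hgs : PowerSeries.HasSubst g := PowerSeries.HasSubst.of_constantCoeff_zero' hg0
  intro N
  induction N with
  | zero => intro r _; exact mem_adicFiltGen_zero _
  | succ N ih =>
    intro r hr
    obtain ⟨r', hr'⟩ : ∃ r' : PowerSeries S, r' = PowerSeries.mk fun i => PowerSeries.coeff (i + 1) r := ⟨_, rfl⟩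
    have hr'mem : r' ∈ adicFiltGen p N := by rw [hr']; simpa using shift_mem_adicFiltGen (p := p) hr
    have e : r = PowerSeries.X * r' + PowerSeries.C (PowerSeries.constantCoeff r) := by
      rw [hr']; exact PowerSeries.eq_X_mul_shift_add_const r
    have hc : PowerSeries.constantCoeff r ∈ Ideal.span {p ^ (N + 1)} := by
      have h := hr 0
      rwa [Nat.sub_zero, PowerSeries.coeff_zero_eq_constantCoeff] at h
    have key : PowerSeries.subst g r = g * PowerSeries.subst g r' + PowerSeries.C (PowerSeries.constantCoeff r) := by
      conv_lhs => rw [e]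
      rw [PowerSeries.subst_add hgs, PowerSeries.subst_mul hgs, PowerSeries.subst_X hgs, PowerSeries.subst_C]
      rfl
    rw [key]
    refine add_mem ?_ (C_mem_adicFiltGen hc)
    have h := mul_mem_adicFiltGen (mem_adicFiltGen_one_of_constantCoeff_eq_zero (p := p) hg0) (ih hr'mem)
    rwa [Nat.add_comm] at h

/-- `G ∈ I_M ⟹ w · G′ ∈ I_{M−1}` for any series `w` (e.g. an invariant differential): differentiation lowers the filtration by one.
[cite: deShalit1987, Ch. I §3.12 Corollary (proof)] -/
theorem mul_derivative_mem_adicFiltGen (w : PowerSeries S) {M : ℕ} {G : PowerSeries S} (hG : G ∈ adicFiltGen p M) :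
    w * d⁄dX S G ∈ adicFiltGen p (M - 1) := by
  have hd : d⁄dX S G ∈ adicFiltGen p (M - 1) := by
    intro k
    rw [PowerSeries.coeff_derivative]
    refine Ideal.mul_mem_right _ _ (Ideal.mem_span_singleton.mpr ?_)
    exact dvd_trans (pow_dvd_pow _ (by omega)) (Ideal.mem_span_singleton.mp (hG (k + 1)))
  have h := mul_mem_adicFiltGen (mem_adicFiltGen_zero (p := p) w) hd
  rwa [Nat.zero_add] at h

/-- Iterating: `G ∈ I_{N+k} ⟹ (w·d/dX)^[k] G ∈ I_N`. [cite: deShalit1987, Ch. I §3.12 Corollary (proof)] -/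
theorem iterate_mul_derivative_mem_adicFiltGen (w : PowerSeries S) (k : ℕ) {N : ℕ} {G : PowerSeries S}
    (hG : G ∈ adicFiltGen p (N + k)) : (fun g : PowerSeries S => w * d⁄dX S g)^[k] G ∈ adicFiltGen p N := by
  induction k generalizing N G with
  | zero => simpa using hG
  | succ k ih =>
    rw [Function.iterate_succ_apply]
    refine ih ?_
    have h := mul_derivative_mem_adicFiltGen (p := p) w hG
    rwa [show N + (k + 1) - 1 = N + k by omega] at h

end SubstFilt

end LubinTate

/-! ### §2. Adic continuity of the moments; `mom_k` as an `𝒪_E`-linear functional -/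

section CoordMomentsLinearTwo

open GaloisRepresentations.IsNonarchimedeanLocalField LubinTate ValuativeRel Field

variable {F : Type} [Field F] [ValuativeRel F] [TopologicalSpace F] [IsNonarchimedeanLocalField F]

attribute [local instance] ltNormUniformSpace ltNormIsUniformAddGroup rk1 nF nE fintypeResidueField

variable {π : 𝒪[F]} (hπ : (valuation F).IsUniformizer (π : F))
variable (E : IntermediateField F (AlgebraicClosure F)) [FiniteDimensional F E]
variable (hq : residueFieldCard F = 2) (u : (LTCoeff F)ˣ) (hu : LTCoeff.of F π = residueFieldCard F * u) (γ : 𝒪[F]ˣ)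

/-- **`Φ(I_N) ⊆ I_N`**: `Φ(r) = (1 + u⁻¹X)·(r ∘ f)` preserves the `(π, Y)`-adic filtration (`f(0) = 0`). [cite: deShalit1987, Ch. I §3.7, §3.13] -/
theorem coordToKer_mem_adicFiltGen {N : ℕ} {r : PowerSeries (unitBall E)}
    (hr : r ∈ adicFiltGen (algebraMap (LTCoeff F) (unitBall E) (LTCoeff.of F π)) N) :
    coordToKer hπ E u r ∈ adicFiltGen (algebraMap (LTCoeff F) (unitBall E) (LTCoeff.of F π)) N := by
  have h := mul_mem_adicFiltGen
    (mem_adicFiltGen_zero (p := algebraMap (LTCoeff F) (unitBall E) (LTCoeff.of F π))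
      (1 + PowerSeries.C (algebraMap (LTCoeff F) (unitBall E) (↑u⁻¹ : LTCoeff F)) * PowerSeries.X))
    (subst_mem_adicFiltGen_of_constantCoeff_eq_zero ((isLTSeries_ltSer π).map (algebraMap (LTCoeff F) (unitBall E))).constantCoeff_eq_zero N hr)
  rw [Nat.zero_add] at h
  exact h

/-- **`D_E^[k](I_{N+k}) ⊆ I_N`** for the relative invariant derivation `D_E = ω_f^E · d/dX`. [cite: deShalit1987, Ch. I §3.5, §3.12 Corollary (proof)] -/
theorem iterate_relDerivation_mem_adicFiltGen (k : ℕ) {N : ℕ} {G : PowerSeries (unitBall E)}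
    (hG : G ∈ adicFiltGen (algebraMap (LTCoeff F) (unitBall E) (LTCoeff.of F π)) (N + k)) :
    (fun g : PowerSeries (unitBall E) =>
        (invDiff (isLTRing_LTCoeff hπ) (isLTSeries_LTCoeff π)).map (algebraMap (LTCoeff F) (unitBall E)) * d⁄dX (unitBall E) g)^[k] G ∈
      adicFiltGen (algebraMap (LTCoeff F) (unitBall E) (LTCoeff.of F π)) N :=
  iterate_mul_derivative_mem_adicFiltGen _ k hG

/-- ★ **ADIC CONTINUITY OF THE MOMENTS: `r ∈ I_{N+k} ⟹ mom_k(r) ∈ (π^N)𝒪_E`** (`Φ` preserves the filtration, `D_E` lowers it by one, `[X⁰](I_N) ⊆ (π^N)`).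
[cite: deShalit1987, Ch. I §3.5 (11), §3.13] -/
theorem coordMoment_mem_of_mem_adicFiltGen (k N : ℕ) (r : PowerSeries (unitBall E))
    (hr : r ∈ adicFiltGen (algebraMap (LTCoeff F) (unitBall E) (LTCoeff.of F π)) (N + k)) :
    coordMoment hπ E u k r ∈ Ideal.span {algebraMap (LTCoeff F) (unitBall E) (LTCoeff.of F π) ^ N} := by
  have h := (iterate_relDerivation_mem_adicFiltGen hπ E k (coordToKer_mem_adicFiltGen hπ E u hr)) 0
  rw [Nat.sub_zero, PowerSeries.coeff_zero_eq_constantCoeff] at h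
  exact h

/-- **`mom_k` as an `𝒪_E`-linear functional `𝒪_E⟦Y⟧ → 𝒪_E`** (`coordMoment_add`, `coordMoment_C_mul`). [cite: deShalit1987, Ch. I §3.5 (i)] -/
def coordMomentₗ (k : ℕ) : PowerSeries (unitBall E) →ₗ[unitBall E] unitBall E where
  toFun := coordMoment hπ E u k
  map_add' := coordMoment_add hπ E u k
  map_smul' c r := by rw [PowerSeries.smul_eq_C_mul, coordMoment_C_mul, RingHom.id_apply, smul_eq_mul]

/-- Unfolding `coordMomentₗ`. [cite: deShalit1987, Ch. I §3.5 (i)] -/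
@[simp] theorem coordMomentₗ_apply (k : ℕ) (r : PowerSeries (unitBall E)) : coordMomentₗ hπ E u k r = coordMoment hπ E u k r := rfl

include hπ hq in
/-- At `q = 2`: **`γ^{k+1} − 1 ∈ (π)𝒪_E`** for every unit `γ ∈ 𝒪_F^×` (the residue field is `𝔽₂`) — the weights `a_k = γ^{k+1} − 1` are
topologically nilpotent. [cite: deShalit1987, Ch. I §3.1 (p = 2)] -/
theorem algebraMap_unit_pow_sub_one_mem (k : ℕ) :
    algebraMap 𝒪[F] (unitBall E) (γ : 𝒪[F]) ^ (k + 1) - 1 ∈ Ideal.span {algebraMap (LTCoeff F) (unitBall E) (LTCoeff.of F π)} := by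
  have h := map_mem_span_singleton_of_mem (algebraMap (LTCoeff F) (unitBall E)) (sub_one_mem_span_pi_of_isUnit_two hπ hq (γ ^ (k + 1)))
  rw [map_sub, map_one, Units.val_pow_eq_pow_val, map_pow, map_pow] at h
  exact h

/-! ### §3. `Λ`-linearity: `mom_k(c • r) = c(γ^{k+1} − 1) · mom_k(r)` -/

variable [IsAdicComplete (Ideal.span {algebraMap (LTCoeff F) (unitBall E) (LTCoeff.of F π)}) (unitBall E)]

include hu in
/-- ★★★ **`mom_k(c(T)·r) = c(γ^{k+1} − 1) · mom_k(r)` for EVERY `c ∈ 𝒪_E⟦T⟧`**, `T` acting as `D_γ = σ_γ − 1` (`tAct`), `c(a) = tEval` the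
`(π)`-adic evaluation: the moment functional is `Λ`-LINEAR from the Coleman coordinate module to `𝒪_E(χ^{k+1})`. [cite: deShalit1987, Ch. I §3.5 (i)–(ii)]
[cite: Washington1997, §13.2] -/
theorem coordMoment_tAct (k : ℕ) (c r : PowerSeries (unitBall E)) :
    coordMoment hπ E u k (tAct (twistLinearBase hπ hq (algebraMap (LTCoeff F) (unitBall E)) u γ)
        (twistLinearBase_mem_adicFiltGen_succ hπ hq (algebraMap (LTCoeff F) (unitBall E)) u hu γ) c r) =
      tEval (algebraMap_unit_pow_sub_one_mem hπ E hq γ k) c * coordMoment hπ E u k r :=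
  apply_tAct_eq_tEval_mul (φ := coordMomentₗ hπ E u k) (algebraMap_unit_pow_sub_one_mem hπ E hq γ k)
    (twistLinearBase_mem_adicFiltGen_succ hπ hq (algebraMap (LTCoeff F) (unitBall E)) u hu γ)
    (fun r => coordMoment_twistLinearBase hπ E hq u hu k γ r) (m := k) (fun N r hr => coordMoment_mem_of_mem_adicFiltGen hπ E u k N r hr) c r

include hu in
/-- ★★★ **Module form: `mom_k(c • r) = c(γ^{k+1} − 1) · mom_k(r)`** on `M = ColemanCoordModule` (`S = 𝒪_E`). [cite: deShalit1987, Ch. I §3.5 (i)–(ii)] -/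
theorem coordMoment_smul (k : ℕ) (c : PowerSeries (unitBall E))
    (r : ColemanCoordModule hπ hq (algebraMap (LTCoeff F) (unitBall E)) u hu γ) :
    coordMoment hπ E u k (TActModule.toPS (c • r)) =
      tEval (algebraMap_unit_pow_sub_one_mem hπ E hq γ k) c * coordMoment hπ E u k (TActModule.toPS r) := by
  rw [TActModule.toPS_smul, coordMoment_tAct hπ E hq u hu γ]

include hu in
/-- ★ **`mom_k` kills `(T − (γ^{k+1} − 1))·M`.** [cite: deShalit1987, Ch. I §3.5 (ii)] [cite: Washington1997, §13.2] -/
theorem coordMoment_X_sub_C_smul (k : ℕ) (r : ColemanCoordModule hπ hq (algebraMap (LTCoeff F) (unitBall E)) u hu γ) :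
    coordMoment hπ E u k (TActModule.toPS
      (((PowerSeries.X : PowerSeries (unitBall E)) - PowerSeries.C (algebraMap 𝒪[F] (unitBall E) (γ : 𝒪[F]) ^ (k + 1) - 1)) • r)) = 0 := by
  rw [coordMoment_smul hπ E hq u hu γ, tEval_X_sub_C, zero_mul]

include hu in
/-- **`mom_k((1+T)^n • r) = γ^{n(k+1)} · mom_k(r)`** (`(1+T)^n ↦ σ_{γ^n}`, `unitTwistₗ_pow`). [cite: deShalit1987, Ch. I §3.5 (ii)] -/
theorem coordMoment_one_add_X_pow_smul (k n : ℕ) (r : ColemanCoordModule hπ hq (algebraMap (LTCoeff F) (unitBall E)) u hu γ) :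
    coordMoment hπ E u k (TActModule.toPS (((1 + PowerSeries.X) ^ n : PowerSeries (unitBall E)) • r)) =
      (algebraMap 𝒪[F] (unitBall E) (γ : 𝒪[F]) ^ (k + 1)) ^ n * coordMoment hπ E u k (TActModule.toPS r) := by
  rw [coordMoment_smul hπ E hq u hu γ, tEval_one_add_X_pow, add_sub_cancel]

include hu in
/-- ★ **`mom_k(σ_v r) = v^{k+1} · mom_k(r)` for the `Λ`-linear unit twists `σ_v = unitTwistₗ v`** (all `v ∈ 𝒪_F^×`, all `r ∈ M`): with
`coordMoment_smul`, `mom_k` is a morphism of `Λ(𝒢)`-modules `M → 𝒪_E(χ^{k+1})`. [cite: deShalit1987, Ch. I §3.4 Lemma (ii), §3.5 (ii)] -/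
theorem coordMoment_unitTwistₗ (k : ℕ) (v : 𝒪[F]ˣ) (r : ColemanCoordModule hπ hq (algebraMap (LTCoeff F) (unitBall E)) u hu γ) :
    coordMoment hπ E u k (TActModule.toPS (unitTwistₗ hπ hq (algebraMap (LTCoeff F) (unitBall E)) u hu γ v r)) =
      algebraMap 𝒪[F] (unitBall E) (v : 𝒪[F]) ^ (k + 1) * coordMoment hπ E u k (TActModule.toPS r) := by
  rw [toPS_unitTwistₗ, coordMoment_twist hπ E hq u hu]

include hu in
/-- `mom_k(σ_v(c • r)) = v^{k+1} c(γ^{k+1} − 1) mom_k(r)`: the two linearities combined. [cite: deShalit1987, Ch. I §3.5 (ii)] -/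
theorem coordMoment_unitTwistₗ_smul (k : ℕ) (v : 𝒪[F]ˣ) (c : PowerSeries (unitBall E))
    (r : ColemanCoordModule hπ hq (algebraMap (LTCoeff F) (unitBall E)) u hu γ) :
    coordMoment hπ E u k (TActModule.toPS (unitTwistₗ hπ hq (algebraMap (LTCoeff F) (unitBall E)) u hu γ v (c • r))) =
      algebraMap 𝒪[F] (unitBall E) (v : 𝒪[F]) ^ (k + 1) * tEval (algebraMap_unit_pow_sub_one_mem hπ E hq γ k) c *
        coordMoment hπ E u k (TActModule.toPS r) := by
  rw [coordMoment_unitTwistₗ hπ E hq u hu γ, coordMoment_smul hπ E hq u hu γ, mul_assoc]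

/-- ★ **`coordMomentΛ k`: the moment functional as a `Λ = 𝒪_E⟦T⟧`-LINEAR map from the Coleman coordinate module to the weight module
`𝒪_E⟦Y⟧(γ^{k+1} − 1)`** (values in the constants; `TActModule.functionalₗ`). [cite: deShalit1987, Ch. I §3.5 (ii)] [cite: Washington1997, §13.2] -/
def coordMomentΛ (k : ℕ) :
    ColemanCoordModule hπ hq (algebraMap (LTCoeff F) (unitBall E)) u hu γ →ₗ[PowerSeries (unitBall E)]
      TActModule (weightOp (algebraMap 𝒪[F] (unitBall E) (γ : 𝒪[F]) ^ (k + 1) - 1))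
        (weightOp_adic (algebraMap_unit_pow_sub_one_mem hπ E hq γ k)) :=
  TActModule.functionalₗ (twistLinearBase hπ hq (algebraMap (LTCoeff F) (unitBall E)) u γ)
    (twistLinearBase_mem_adicFiltGen_succ hπ hq (algebraMap (LTCoeff F) (unitBall E)) u hu γ)
    (algebraMap_unit_pow_sub_one_mem hπ E hq γ k) (coordMomentₗ hπ E u k)
    (fun r => coordMoment_twistLinearBase hπ E hq u hu k γ r) k (fun N r hr => coordMoment_mem_of_mem_adicFiltGen hπ E u k N r hr)

/-- Unfolding `coordMomentΛ`: `toPS (coordMomentΛ k r) = C (mom_k (toPS r))`. [cite: deShalit1987, Ch. I §3.5 (ii)] -/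
@[simp] theorem toPS_coordMomentΛ_apply (k : ℕ) (r : ColemanCoordModule hπ hq (algebraMap (LTCoeff F) (unitBall E)) u hu γ) :
    TActModule.toPS (coordMomentΛ hπ E hq u hu γ k r) = PowerSeries.C (coordMoment hπ E u k (TActModule.toPS r)) := rfl

/-- `coordMomentΛ k r = 0 ↔ mom_k (toPS r) = 0`. [cite: deShalit1987, Ch. I §3.5 (ii)] -/
theorem coordMomentΛ_eq_zero_iff (k : ℕ) (r : ColemanCoordModule hπ hq (algebraMap (LTCoeff F) (unitBall E)) u hu γ) :
    coordMomentΛ hπ E hq u hu γ k r = 0 ↔ coordMoment hπ E u k (TActModule.toPS r) = 0 :=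
  TActModule.functionalₗ_eq_zero_iff _ _ _ _ _ _ _ r

/-- The submodule `(T − (γ^{k+1} − 1))·M` lies in the kernel of `coordMomentΛ k`. [cite: deShalit1987, Ch. I §3.5 (ii)] -/
theorem range_X_sub_C_smul_le_ker_coordMomentΛ (k : ℕ) :
    LinearMap.range (((PowerSeries.X : PowerSeries (unitBall E)) - PowerSeries.C (algebraMap 𝒪[F] (unitBall E) (γ : 𝒪[F]) ^ (k + 1) - 1)) •
        (LinearMap.id : ColemanCoordModule hπ hq (algebraMap (LTCoeff F) (unitBall E)) u hu γ →ₗ[PowerSeries (unitBall E)]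
          ColemanCoordModule hπ hq (algebraMap (LTCoeff F) (unitBall E)) u hu γ)) ≤
      LinearMap.ker (coordMomentΛ hπ E hq u hu γ k) := by
  rintro r ⟨s, rfl⟩
  rw [LinearMap.mem_ker, coordMomentΛ_eq_zero_iff]
  exact coordMoment_X_sub_C_smul hπ E hq u hu γ k s

/-! ### §4. On the coordinates of the units: the `Λ`-span of `Col(𝒰)` read at weight `k+1` -/

section Units

variable [Normal F E] [IsGalois F E] (hE : E ≤ maxUnramified F) {σ₀ : absoluteGaloisGroup F} (hσ₀ : IsAbsArithFrob σ₀)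

include hu in
/-- ★★ **`mom_k(c • r_β) = c(γ^{k+1} − 1) · (c_β − u·π^k·φ(c_β))`**, `c_β = [X⁰] D_E^[k](δ_E g_β)` the relative Coates–Wiles value of the
norm-coherent unit `β` (`coordMoment_relUnitCoordTwo_eq_coatesWiles`): the `Λ`-multiples of the Coleman coordinates of the units are read at
weight `k+1` through the Euler-twisted Coates–Wiles homomorphism. [cite: deShalit1987, Ch. I §3.5 (11) (i)–(ii); Ch. II §4.7 (17)] -/
theorem coordMoment_smul_relUnitCoordTwo_eq_coatesWiles (k : ℕ) (c : PowerSeries (unitBall E)) (β : RelNormCoherentUnits hπ E) :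
    coordMoment hπ E u k (TActModule.toPS (c • (TActModule.ofPS (twistLinearBase hπ hq (algebraMap (LTCoeff F) (unitBall E)) u γ)
      (twistLinearBase_mem_adicFiltGen_succ hπ hq (algebraMap (LTCoeff F) (unitBall E)) u hu γ)
        (relUnitCoordTwo hπ E hq hE hσ₀ u hu β)))) =
      tEval (algebraMap_unit_pow_sub_one_mem hπ E hq γ k) c *
        (PowerSeries.constantCoeff ((fun g : PowerSeries (unitBall E) =>
            (invDiff (isLTRing_LTCoeff hπ) (isLTSeries_LTCoeff π)).map (algebraMap (LTCoeff F) (unitBall E)) *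
              d⁄dX (unitBall E) g)^[k] (relLogDerivSeries hπ E hq hE hσ₀ β)) -
          algebraMap (LTCoeff F) (unitBall E) (u : LTCoeff F) * algebraMap (LTCoeff F) (unitBall E) (LTCoeff.of F π) ^ k *
            (frobUnitBall E σ₀ : unitBall E →+* unitBall E)
              (PowerSeries.constantCoeff ((fun g : PowerSeries (unitBall E) =>
                (invDiff (isLTRing_LTCoeff hπ) (isLTSeries_LTCoeff π)).map (algebraMap (LTCoeff F) (unitBall E)) *
                  d⁄dX (unitBall E) g)^[k] (relLogDerivSeries hπ E hq hE hσ₀ β)))) := by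
  rw [coordMoment_smul hπ E hq u hu γ, TActModule.toPS_ofPS, coordMoment_relUnitCoordTwo_eq_coatesWiles hπ E hq hE hσ₀ u hu]

include hu in
/-- **`mom_k(σ_v (c • r_β)) = v^{k+1} · c(γ^{k+1} − 1) · mom_k(r_β)`** — the full `Λ(𝒢)`-equivariance on the image of the units.
[cite: deShalit1987, Ch. I §3.4 Lemma (ii), §3.5 (ii)] -/
theorem coordMoment_unitTwistₗ_smul_relUnitCoordTwo (k : ℕ) (v : 𝒪[F]ˣ) (c : PowerSeries (unitBall E)) (β : RelNormCoherentUnits hπ E) :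
    coordMoment hπ E u k (TActModule.toPS (unitTwistₗ hπ hq (algebraMap (LTCoeff F) (unitBall E)) u hu γ v
      (c • (TActModule.ofPS (twistLinearBase hπ hq (algebraMap (LTCoeff F) (unitBall E)) u γ)
        (twistLinearBase_mem_adicFiltGen_succ hπ hq (algebraMap (LTCoeff F) (unitBall E)) u hu γ)
          (relUnitCoordTwo hπ E hq hE hσ₀ u hu β))))) =
      algebraMap 𝒪[F] (unitBall E) (v : 𝒪[F]) ^ (k + 1) * tEval (algebraMap_unit_pow_sub_one_mem hπ E hq γ k) c *
        coordMoment hπ E u k (relUnitCoordTwo hπ E hq hE hσ₀ u hu β) := by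
  rw [coordMoment_unitTwistₗ_smul hπ E hq u hu γ, TActModule.toPS_ofPS]

end Units

end CoordMomentsLinearTwo

end Literature.NumberTheory.GaloisRepresentations
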